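import Mathlib
import Literature.AlgebraicGeometry.Resolution.CobordantChartCoefficients
import Literature.AlgebraicGeometry.Resolution.AxisPolyhedron
import Literature.AlgebraicGeometry.Resolution.FormalCoordinateChange
import Literature.AlgebraicGeometry.Resolution.FormalInverseFunction
import Summits.ResolutionOfSingularities.ResolutionOfSingularities.Theorems.WeightedInvariantLocalWeightedDropTschirnhausFormAux
import Summits.ResolutionOfSingularities.ResolutionOfSingularities.Theorems.WeightedInvariantLocalWeightedDropApexFreeOrderDrop

/-!
# Helpers for the axis preparation (Hironaka's vertex dissolution, one free variable) — shear calculus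

Crux `LocalWeightedDrop` (stmt-ResolutionOfSingularities-8899, route ResolutionOfSingularities/WeightedInvariant),
line `hasse-ridge-face-selection`, registered stub `stub_axisPreparation` (file
`WeightedInvariantLocalWeightedDropAxisPreparation`).  Vocabulary of `Literature/…/AxisPolyhedron.lean`: in
`k[[x'₁, …, x'ₙ, z]]` the free variable is `z = X (Fin.last n)`, `x'_j = X (Fin.castSucc j)`; `xDeg E` is the
`x'`-degree of an exponent, `IsZOnly ψ` says `ψ` is a series in `z` alone, `shearFam ψ` is the shear
`x'_j ↦ x'_j - ψ_j`, `z ↦ z`.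

* exponent bookkeeping (`xDeg_add`, `degree_eq_xDeg_add`, `eq_single_of_xDeg_eq_zero`);
* `z`-only series are FIXED by every substitution family fixing `z` (`subst_eq_self_of_isZOnly`), hence shears by
  `z`-only vectors compose additively (`subst_shearFam_shearFam`; registered sub-goal
  `stub_axisPreparationShearCompose` at the end of the file);
* a shear by a `z`-only vector without constant and linear terms is tangent to the identity
  (`tangentId_shearFam`): its linear part is the identity matrix (`isUnit_det_shearFam`) and it does not change
  the coefficients of degree `≤ ord g` (`FormalCoordChange.TangentId.coeff_subst_of_degree_le`), so the order `d`,
  `AxisCone d` and `TrivialApexX d` are preserved (`order_axisCone_trivialApexX_of_coeff_eq`);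
* WEIGHTS `(M, …, M, 1)` (`weight_snoc : weight = M · xDeg E + E z`): substituting a family whose members have
  weighted order at least the weights of the variables creates no coefficient below a weighted order bound of the
  input (`coeff_subst_eq_zero_of_weight_lt`); the monomial shear `x' ↦ x' - μ z^M` is such a family
  (`weight_le_weightedOrder_shearFam_monomial`); arithmetic of `M x + c` versus `M d` (`weight_lt_iff`, `weight_le_iff`).
-/

set_option linter.dupNamespace false -- mandated namespace of this single-conjunct summit

namespace Summit.ResolutionOfSingularities.ResolutionOfSingularities.Theorems

open Literature.AlgebraicGeometry.Resolution

namespace AxisPreparation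

open MvPowerSeries AxisPolyhedron

variable {k : Type} [Field k] {n : ℕ}

/-! ### Exponent bookkeeping -/

/-- `xDeg` is additive. -/
theorem xDeg_add (E F : Fin (n + 1) →₀ ℕ) : xDeg (E + F) = xDeg E + xDeg F := by
  simp only [xDeg, Finsupp.add_apply, Finset.sum_add_distrib]

/-- The total degree is the `x'`-degree plus the `z`-exponent. -/
theorem degree_eq_xDeg_add (E : Fin (n + 1) →₀ ℕ) : E.degree = xDeg E + E (Fin.last n) := by
  rw [Finsupp.degree_eq_sum, Fin.sum_univ_castSucc, xDeg]

/-- `xDeg` of a pure `z`-power vanishes. -/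
theorem xDeg_single_last (c : ℕ) : xDeg (Finsupp.single (Fin.last n) c) = 0 := by
  refine Finset.sum_eq_zero fun j _ => ?_
  exact Finsupp.single_eq_of_ne (Fin.castSucc_lt_last j).ne

/-- `xDeg` of a unit vector at an axis variable is `1`·`c`. -/
theorem xDeg_single_castSucc (j : Fin n) (c : ℕ) : xDeg (Finsupp.single (Fin.castSucc j) c) = c := by
  rw [xDeg, Finset.sum_eq_single j]
  · exact Finsupp.single_eq_same
  · intro j' _ hj'
    exact Finsupp.single_eq_of_ne (fun h => hj' (Fin.castSucc_injective n h))
  · exact fun h => absurd (Finset.mem_univ j) h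

/-- An exponent of `x'`-degree `0` is a pure `z`-power. -/
theorem eq_single_of_xDeg_eq_zero {E : Fin (n + 1) →₀ ℕ} (h : xDeg E = 0) :
    E = Finsupp.single (Fin.last n) (E (Fin.last n)) := by
  have h' : ∀ j : Fin n, E (Fin.castSucc j) = 0 := fun j =>
    (Finset.sum_eq_zero_iff.mp h) j (Finset.mem_univ j)
  ext l
  rcases Fin.eq_castSucc_or_eq_last l with ⟨j, rfl⟩ | rfl
  · rw [h' j, Finsupp.single_eq_of_ne (Fin.castSucc_lt_last j).ne]
  · rw [Finsupp.single_eq_same]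

/-! ### `z`-only series -/

/-- `0` is `z`-only. -/
theorem isZOnly_zero : IsZOnly (0 : MvPowerSeries (Fin (n + 1)) k) := fun _ hE => absurd (map_zero _) hE

/-- Sums of `z`-only series are `z`-only. -/
theorem IsZOnly.add {φ ψ : MvPowerSeries (Fin (n + 1)) k} (hφ : IsZOnly φ) (hψ : IsZOnly ψ) :
    IsZOnly (φ + ψ) := by
  intro E hE
  rw [map_add] at hE
  by_cases h : coeff E φ = 0
  · rw [h, zero_add] at hE
    exact hψ E hE
  · exact hφ E h

/-- `λ · z^M` is `z`-only. -/
theorem isZOnly_C_mul_X_pow (μ : k) (M : ℕ) :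
    IsZOnly (C μ * X (Fin.last n) ^ M : MvPowerSeries (Fin (n + 1)) k) := by
  classical
  intro E hE
  rw [coeff_C_mul, coeff_X_pow] at hE
  by_cases h : E = Finsupp.single (Fin.last n) M
  · rw [h, xDeg_single_last]
  · rw [if_neg h, mul_zero] at hE
    exact absurd rfl hE

/-- A `z`-ONLY SERIES IS FIXED by every substitution family (zero constant terms) that fixes `z`. -/
theorem subst_eq_self_of_isZOnly {a : Fin (n + 1) → MvPowerSeries (Fin (n + 1)) k}
    (ha : ∀ l, constantCoeff (a l) = 0) (hz : a (Fin.last n) = X (Fin.last n))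
    {φ : MvPowerSeries (Fin (n + 1)) k} (hφ : IsZOnly φ) : subst a φ = φ := by
  classical
  ext E
  rw [coeff_subst (hasSubst_of_constantCoeff_zero ha)]
  have hterm : ∀ B : Fin (n + 1) →₀ ℕ,
      coeff B φ • coeff E (B.prod fun l m => a l ^ m) = if B = E then coeff E φ else 0 := by
    intro B
    by_cases hB : coeff B φ = 0
    · rw [hB, zero_smul]
      split_ifs with h
      · rw [← h, hB]
      · rfl
    have hBz : B = Finsupp.single (Fin.last n) (B (Fin.last n)) := eq_single_of_xDeg_eq_zero (hφ B hB)
    have hprod : (B.prod fun l m => a l ^ m) = X (Fin.last n) ^ B (Fin.last n) := by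
      conv_lhs => rw [hBz]
      rw [Finsupp.prod_single_index (h := fun l m => a l ^ m) (pow_zero _), hz]
    rw [hprod, coeff_X_pow, smul_eq_mul]
    by_cases h : B = E
    · subst h
      rw [if_pos hBz, if_pos rfl, mul_one]
    · rw [if_neg (fun h' => h (h'.trans hBz.symm).symm), if_neg h, mul_zero]
  simp_rw [hterm]
  rw [finsum_eq_single _ E (fun B hB => if_neg hB), if_pos rfl]

/-- The monomial `μ z^M`, `M ≥ 1`, has no constant term. -/
theorem constantCoeff_C_mul_X_pow (μ : k) {M : ℕ} (hM : M ≠ 0) :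
    constantCoeff (C μ * X (Fin.last n) ^ M : MvPowerSeries (Fin (n + 1)) k) = 0 := by
  rw [map_mul, map_pow, constantCoeff_X, zero_pow hM, mul_zero]

/-- The monomial `μ z^M`, `M ≠ 1`, has no linear term in `z`. -/
theorem coeff_single_C_mul_X_pow (μ : k) {M : ℕ} (hM : M ≠ 1) :
    coeff (Finsupp.single (Fin.last n) 1) (C μ * X (Fin.last n) ^ M : MvPowerSeries (Fin (n + 1)) k) = 0 := by
  classical
  rw [coeff_C_mul, coeff_X_pow, if_neg, mul_zero]
  intro h
  exact hM (Finsupp.single_injective _ h).symm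

/-! ### Shears by `z`-only vectors -/

/-- The shear family has zero constant terms when `ψ` does. -/
theorem constantCoeff_shearFam {ψ : Fin n → MvPowerSeries (Fin (n + 1)) k}
    (h0 : ∀ j, constantCoeff (ψ j) = 0) (l : Fin (n + 1)) : constantCoeff (shearFam ψ l) = 0 := by
  rcases Fin.eq_castSucc_or_eq_last l with ⟨j, rfl⟩ | rfl
  · rw [shearFam_castSucc, map_sub, constantCoeff_X, h0 j, sub_zero]
  · rw [shearFam_last, constantCoeff_X]

/-- The shear family is substitutable. -/
theorem hasSubst_shearFam {ψ : Fin n → MvPowerSeries (Fin (n + 1)) k} (h0 : ∀ j, constantCoeff (ψ j) = 0) :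
    HasSubst (shearFam ψ) :=
  hasSubst_of_constantCoeff_zero (constantCoeff_shearFam h0)

/-- Linear coefficients of the shear family: the identity matrix, when `ψ` is `z`-only without linear term. -/
theorem coeff_single_shearFam {ψ : Fin n → MvPowerSeries (Fin (n + 1)) k} (hz : ∀ j, IsZOnly (ψ j))
    (h1 : ∀ j, coeff (Finsupp.single (Fin.last n) 1) (ψ j) = 0) (i l : Fin (n + 1)) :
    coeff (Finsupp.single l 1) (shearFam ψ i) = if i = l then 1 else 0 := by
  classical
  have hψ : ∀ j, coeff (Finsupp.single l 1) (ψ j) = 0 := by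
    intro j
    rcases Fin.eq_castSucc_or_eq_last l with ⟨j', rfl⟩ | rfl
    · by_contra hne
      have := hz j _ hne
      rw [xDeg_single_castSucc] at this
      exact one_ne_zero this
    · exact h1 j
  have hX : ∀ s : Fin (n + 1), coeff (Finsupp.single l 1) (X s : MvPowerSeries (Fin (n + 1)) k) =
      if s = l then 1 else 0 := by
    intro s
    rw [coeff_X]
    by_cases h : s = l
    · subst h
      rw [if_pos rfl, if_pos rfl]
    · rw [if_neg (fun h' => h ((Finsupp.single_left_inj one_ne_zero).mp h').symm), if_neg h]
  rcases Fin.eq_castSucc_or_eq_last i with ⟨j, rfl⟩ | rfl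
  · rw [shearFam_castSucc, map_sub, hψ j, sub_zero, hX]
  · rw [shearFam_last, hX]

/-- Such a shear is TANGENT TO THE IDENTITY. -/
theorem tangentId_shearFam {ψ : Fin n → MvPowerSeries (Fin (n + 1)) k} (hz : ∀ j, IsZOnly (ψ j))
    (h0 : ∀ j, constantCoeff (ψ j) = 0) (h1 : ∀ j, coeff (Finsupp.single (Fin.last n) 1) (ψ j) = 0) :
    FormalCoordChange.TangentId (shearFam ψ) :=
  ⟨constantCoeff_shearFam h0, fun i l => coeff_single_shearFam hz h1 i l⟩

/-- Its linear part is the identity matrix, so the determinant is a unit. -/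
theorem isUnit_det_shearFam {ψ : Fin n → MvPowerSeries (Fin (n + 1)) k} (hz : ∀ j, IsZOnly (ψ j))
    (h1 : ∀ j, coeff (Finsupp.single (Fin.last n) 1) (ψ j) = 0) :
    IsUnit (Matrix.det (Matrix.of fun i j => coeff (Finsupp.single j 1) (shearFam ψ i))) := by
  have : (Matrix.of fun i j => coeff (Finsupp.single j 1) (shearFam ψ i)) = 1 := by
    ext i j
    rw [Matrix.of_apply, coeff_single_shearFam hz h1, Matrix.one_apply]
  rw [this, Matrix.det_one]
  exact isUnit_one

/-- SHEARS BY `z`-ONLY VECTORS COMPOSE ADDITIVELY: shearing by `ψ'` and then by `ψ` is shearing by `ψ' + ψ`. -/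
theorem subst_shearFam_shearFam {ψ ψ' : Fin n → MvPowerSeries (Fin (n + 1)) k}
    (h0 : ∀ j, constantCoeff (ψ j) = 0) (h0' : ∀ j, constantCoeff (ψ' j) = 0) (hz' : ∀ j, IsZOnly (ψ' j))
    (g : MvPowerSeries (Fin (n + 1)) k) :
    subst (shearFam ψ) (subst (shearFam ψ') g) = subst (shearFam (ψ' + ψ)) g := by
  rw [subst_comp_subst_apply (hasSubst_shearFam h0') (hasSubst_shearFam h0)]
  congr 1
  funext l
  rcases Fin.eq_castSucc_or_eq_last l with ⟨j, rfl⟩ | rfl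
  · rw [shearFam_castSucc, shearFam_castSucc, subst_sub (hasSubst_shearFam h0), subst_X (hasSubst_shearFam h0),
      shearFam_castSucc, subst_eq_self_of_isZOnly (constantCoeff_shearFam h0) (shearFam_last ψ) (hz' j),
      Pi.add_apply]
    ring
  · rw [shearFam_last, subst_X (hasSubst_shearFam h0), shearFam_last, shearFam_last]

/-! ### Transfer of the order, `AxisCone` and `TrivialApexX` -/

/-- `initEval` with unit weights only reads the degree-`d` coefficients. -/
theorem initEval_congr {g g' : MvPowerSeries (Fin (n + 1)) k} {d : ℕ}
    (h : ∀ E : Fin (n + 1) →₀ ℕ, E.degree = d → coeff E g' = coeff E g) (w : Fin (n + 1) → k) :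
    CobordantChart.initEval (fun _ => 1) w d g' = CobordantChart.initEval (fun _ => 1) w d g := by
  unfold CobordantChart.initEval
  refine finsum_congr fun E => ?_
  split_ifs with hE
  · rw [h E (by rwa [ApexFreeOrderDrop.weight_one_eq_degree] at hE)]
  · rfl

/-- TRANSFER: a series with the same coefficients as `g` in degrees `≤ d = ord g` has order `d`, and inherits
`AxisCone d` and `TrivialApexX d` from `g`. -/
theorem order_axisCone_trivialApexX_of_coeff_eq {g g' : MvPowerSeries (Fin (n + 1)) k} {d : ℕ}
    (h : ∀ E : Fin (n + 1) →₀ ℕ, E.degree ≤ d → coeff E g' = coeff E g) (hd : g.order = d) :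
    g'.order = d ∧ (AxisCone d g → AxisCone d g') ∧ (TrivialApexX d g → TrivialApexX d g') := by
  refine ⟨?_, fun hc E hE hz => ?_, fun ha u hu => ?_⟩
  · rw [order_eq_nat] at hd ⊢
    obtain ⟨⟨E, hE, hEd⟩, hlow⟩ := hd
    exact ⟨⟨E, by rwa [h E hEd.le], hEd⟩, fun E hE => by rw [h E hE.le]; exact hlow E hE⟩
  · rw [h E hE.le]
    exact hc E hE hz
  · obtain ⟨v, hv⟩ := ha u hu
    refine ⟨v, ?_⟩
    rwa [initEval_congr (fun E hE => h E hE.le), initEval_congr (fun E hE => h E hE.le)]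

/-- A shear by a `z`-only vector without constant and linear terms does not change the coefficients of degree
`≤ ord g`; hence (with the transfer lemma) it preserves the order `d`, `AxisCone d` and `TrivialApexX d`. -/
theorem coeff_subst_shearFam_of_degree_le {ψ : Fin n → MvPowerSeries (Fin (n + 1)) k} (hz : ∀ j, IsZOnly (ψ j))
    (h0 : ∀ j, constantCoeff (ψ j) = 0) (h1 : ∀ j, coeff (Finsupp.single (Fin.last n) 1) (ψ j) = 0)
    (g : MvPowerSeries (Fin (n + 1)) k) {E : Fin (n + 1) →₀ ℕ} (hE : (E.degree : ℕ∞) ≤ g.order) :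
    coeff E (subst (shearFam ψ) g) = coeff E g :=
  (tangentId_shearFam hz h0 h1).coeff_subst_of_degree_le g E hE

/-! ### Weights `(M, …, M, 1)` and substitution -/

/-- The weight of an exponent for the weights `(M, …, M, 1)` is `M · xDeg E + E z`. -/
theorem weight_snoc (M : ℕ) (E : Fin (n + 1) →₀ ℕ) :
    Finsupp.weight (Fin.snoc (fun _ : Fin n => M) 1 : Fin (n + 1) → ℕ) E = M * xDeg E + E (Fin.last n) := by
  rw [Finsupp.weight_apply, Finsupp.sum_fintype _ _ (fun _ => by simp), Fin.sum_univ_castSucc]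
  simp only [Fin.snoc_castSucc, Fin.snoc_last, smul_eq_mul, mul_one, xDeg, Finset.mul_sum]
  congr 1
  exact Finset.sum_congr rfl fun j _ => mul_comm _ _

/-- WEIGHTED VANISHING UNDER SUBSTITUTION: if every `a l` has weighted order `≥ w l` and `f` has no coefficient of
weight `< N`, then `f(a)` has no coefficient of weight `< N`. -/
theorem coeff_subst_eq_zero_of_weight_lt {σ : Type} [Fintype σ] (w : σ → ℕ) {a : σ → MvPowerSeries σ k}
    (ha : ∀ l, constantCoeff (a l) = 0) (hw : ∀ l, ((w l : ℕ) : ℕ∞) ≤ (a l).weightedOrder w)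
    {f : MvPowerSeries σ k} {N : ℕ} (hf : ∀ B, Finsupp.weight w B < N → coeff B f = 0)
    (E : σ →₀ ℕ) (hE : Finsupp.weight w E < N) : coeff E (subst a f) = 0 := by
  rw [coeff_subst (hasSubst_of_constantCoeff_zero ha)]
  refine finsum_eq_zero_of_forall_eq_zero fun B => ?_
  by_cases hB : Finsupp.weight w B < N
  · rw [hf B hB, zero_smul]
  · push Not at hB
    rw [coeff_eq_zero_of_lt_weightedOrder w (d := E) ?_, smul_zero]
    have hcast : ((Finsupp.weight w B : ℕ) : ℕ∞) = ∑ l, B l • ((w l : ℕ) : ℕ∞) := by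
      rw [Finsupp.weight_apply, Finsupp.sum_fintype _ _ (fun _ => by simp), Nat.cast_sum]
      exact Finset.sum_congr rfl fun l _ => by simp [nsmul_eq_mul]
    calc ((Finsupp.weight w E : ℕ) : ℕ∞) < N := by exact_mod_cast hE
      _ ≤ Finsupp.weight w B := by exact_mod_cast hB
      _ = ∑ l, B l • ((w l : ℕ) : ℕ∞) := hcast
      _ ≤ ∑ l, B l • (a l).weightedOrder w := Finset.sum_le_sum fun l _ => nsmul_le_nsmul_right (hw l) _
      _ ≤ ∑ l, ((a l) ^ (B l)).weightedOrder w := Finset.sum_le_sum fun l _ => le_weightedOrder_pow w _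
      _ ≤ (∏ l, (a l) ^ (B l)).weightedOrder w := le_weightedOrder_prod w _ _
      _ = (B.prod fun l m => a l ^ m).weightedOrder w := by rw [Finsupp.prod_fintype _ _ (fun _ => pow_zero _)]

/-- The monomial shear `x'_j ↦ x'_j - μ_j z^M`, `z ↦ z` has weighted orders `≥ (M, …, M, 1)`. -/
theorem weight_le_weightedOrder_shearFam_monomial (μ : Fin n → k) (M : ℕ) (l : Fin (n + 1)) :
    (((Fin.snoc (fun _ : Fin n => M) 1 : Fin (n + 1) → ℕ) l : ℕ) : ℕ∞) ≤
      (shearFam (fun j => C (μ j) * X (Fin.last n) ^ M) l).weightedOrder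
        (Fin.snoc (fun _ : Fin n => M) 1 : Fin (n + 1) → ℕ) := by
  classical
  apply nat_le_weightedOrder
  intro D hD
  rw [weight_snoc] at hD
  rcases Fin.eq_castSucc_or_eq_last l with ⟨j, rfl⟩ | rfl
  · rw [Fin.snoc_castSucc] at hD
    rw [shearFam_castSucc, map_sub, coeff_X, coeff_C_mul, coeff_X_pow]
    have h1 : D ≠ Finsupp.single (Fin.castSucc j) 1 := by
      rintro rfl
      rw [xDeg_single_castSucc, Finsupp.single_eq_of_ne (Fin.castSucc_lt_last j).ne'] at hD
      omega
    have h2 : D ≠ Finsupp.single (Fin.last n) M := by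
      rintro rfl
      rw [xDeg_single_last, Finsupp.single_eq_same] at hD
      omega
    rw [if_neg h1, if_neg h2, mul_zero, sub_zero]
  · rw [Fin.snoc_last] at hD
    rw [shearFam_last, coeff_X]
    have h1 : D ≠ Finsupp.single (Fin.last n) 1 := by
      rintro rfl
      rw [xDeg_single_last, Finsupp.single_eq_same] at hD
      omega
    rw [if_neg h1]

/-! ### Arithmetic of the weights `M · x + c` -/

/-- Below the level: `M x + c < M d` iff `x < d` and `c < M (d - x)`. -/
theorem weight_lt_iff {M x c d : ℕ} : M * x + c < M * d ↔ x < d ∧ c < M * (d - x) := by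
  constructor
  · intro h
    have hx : x < d := by
      by_contra hx
      push Not at hx
      have := Nat.mul_le_mul_left M hx
      omega
    obtain ⟨t, rfl⟩ := Nat.exists_eq_add_of_lt hx
    refine ⟨hx, ?_⟩
    rw [show x + t + 1 - x = t + 1 by omega]
    have : M * (x + t + 1) = M * x + M * (t + 1) := by ring
    omega
  · rintro ⟨hx, hc⟩
    obtain ⟨t, rfl⟩ := Nat.exists_eq_add_of_lt hx
    rw [show x + t + 1 - x = t + 1 by omega] at hc
    have : M * (x + t + 1) = M * x + M * (t + 1) := by ring
    omega

/-- On or below the level: for `x ≤ d`, `M x + c ≤ M d` iff `c ≤ M (d - x)`. -/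
theorem weight_le_iff {M x c d : ℕ} (hx : x ≤ d) : M * x + c ≤ M * d ↔ c ≤ M * (d - x) := by
  obtain ⟨t, rfl⟩ := Nat.exists_eq_add_of_le hx
  rw [Nat.add_sub_cancel_left, mul_add]
  omega

end AxisPreparation

/-- Registered sub-goal `stub_axisPreparationShearCompose` of `stub_axisPreparation` (every field): SHEARS BY `z`-ONLY
VECTORS COMPOSE ADDITIVELY — shearing `g` by a `z`-only vector `ψ'` (zero constant terms) and then by `ψ` (zero
constant terms) is shearing by `ψ' + ψ`, because a shear fixes `z` and hence every series in `z` alone. -/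
theorem stub_axisPreparationShearCompose : ∀ (k : Type) [Field k] (n : ℕ)
    (ψ ψ' : Fin n → MvPowerSeries (Fin (n + 1)) k) (g : MvPowerSeries (Fin (n + 1)) k),
    (∀ j, MvPowerSeries.constantCoeff (ψ j) = 0) → (∀ j, MvPowerSeries.constantCoeff (ψ' j) = 0) →
    (∀ j, AxisPolyhedron.IsZOnly (ψ' j)) →
    MvPowerSeries.subst (AxisPolyhedron.shearFam ψ) (MvPowerSeries.subst (AxisPolyhedron.shearFam ψ') g) =
      MvPowerSeries.subst (AxisPolyhedron.shearFam (ψ' + ψ)) g := by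
  intro k _ n ψ ψ' g h0 h0' hz'
  exact AxisPreparation.subst_shearFam_shearFam h0 h0' hz' g

end Summit.ResolutionOfSingularities.ResolutionOfSingularities.Theorems
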